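import Literature.Probability.Distributions.GaussianHypercontractivity
import Literature.Computability.AlgebraicComplexity.AndrewsForbes2022Thm38Proofs
import Mathlib.Probability.Distributions.Gaussian.Multivariate
import Mathlib.Analysis.CStarAlgebra.Matrix
import Mathlib.Topology.Algebra.MvPolynomial

/-!
# Gaussian hypercontractivity for Mathlib's multivariate Gaussian `N(0, S)`
# — toward E(5) «moments via B» of STUB-PLAN-E for stub E `stub_tiltMoments` of LINE-17 (crux `BoxMidWindowsSU22`, stmt-QuantumFields-24003)

Obligation B of LINE-17 (`GaussPolyHypercontractivity`, landed as `…GaussHypercontractivity.stub_gaussPolyHypercontractivity` from the tree's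
`Literature.Probability.Distributions.gaussian_bonami_pi`) is stated for the PRODUCT standard Gaussian `⊗_i N(0,1)` on `ℝ^n`.  The line's Gaussians
(`boxDirichlet H = LatticeMaxwell.τ … = multivariateGaussian 0 Q_D⁻¹`, `gaussD`) are general centred multivariate Gaussians.  This file transfers the
inequality: for ANY real matrix `S` (Mathlib's `multivariateGaussian 0 S` is the image of the standard Gaussian under `y ↦ √S y`, `√S = CFC.sqrt S`),
any `P : MvPolynomial ι ℝ` with `totalDegree P ≤ d` and `r ≥ 1`,

  `∫ (eval y P)^{2r} dN(0,S) ≤ (2r − 1)^{rd} · (∫ (eval y P)² dN(0,S))^r`   (`multivariateGaussian_bonami`).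

Proof: `N(0,S) = (⊗_i N(0,1)).map (z ↦ √S z)` (Mathlib `map_pi_eq_stdGaussian`); `eval (√S z) P = eval z (bind₁ ℓ P)` for the linear substitution
`ℓ i = Σ_j C (√S)_{ij} X_j`, which does not raise the total degree (tree `Theorem38.totalDegree_bind₁_le_of_le_one`, `totalDegree_linear_le`);
then the tree's `gaussian_bonami_pi'`.  Pure Mathlib + Literature; no definition.
HONEST LABEL: helper for an open registered stub of a critic-passed line on the R2ξ″ RECORD-rung crux 24003; no stub is proved by name, no crux,
rung or summit is proved; the Yang–Mills mass gap is NOT proved by this.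
-/

set_option autoImplicit false

noncomputable section

open MeasureTheory ProbabilityTheory Finset MvPolynomial
open scoped Matrix MatrixOrder

namespace Summit.QuantumFields.YangMills.Theorems.AllWindowsColdBox.GaussHypercontractivity

variable {ι : Type*} [Fintype ι] [DecidableEq ι]

omit [DecidableEq ι] in
/-- The linear substitution `X_i ↦ Σ_j A_{ij} X_j` evaluates to `A z`: `eval z (bind₁ ℓ_A P) = eval (A z) P`. -/
theorem eval_bind₁_linear (A : Matrix ι ι ℝ) (P : MvPolynomial ι ℝ) (z : ι → ℝ) :
    eval z (bind₁ (fun i => ∑ j, C (A i j) * X j) P) = eval (A *ᵥ z) P := by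
  have hl : ∀ i, eval z (∑ j, C (A i j) * X j : MvPolynomial ι ℝ) = (A *ᵥ z) i := fun i => by
    simp [Matrix.mulVec, dotProduct]
  show eval₂Hom (RingHom.id ℝ) z (bind₁ (fun i => ∑ j, C (A i j) * X j) P) = _
  rw [eval₂Hom_bind₁]
  show eval (fun i => eval z (∑ j, C (A i j) * X j : MvPolynomial ι ℝ)) P = _
  simp_rw [hl]

omit [DecidableEq ι] in
/-- The linear substitution does not raise the total degree. -/
theorem totalDegree_bind₁_linear_le (A : Matrix ι ι ℝ) (P : MvPolynomial ι ℝ) :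
    (bind₁ (fun i => ∑ j, C (A i j) * X j) P).totalDegree ≤ P.totalDegree :=
  Literature.Computability.AlgebraicComplexity.Theorem38.totalDegree_bind₁_le_of_le_one _
    (fun i => Literature.Computability.AlgebraicComplexity.Theorem38.totalDegree_linear_le fun j => A i j) P

/-- Transport of polynomial moments: `∫ (eval y P)^q dN(0,S) = ∫ (eval z (bind₁ ℓ_{√S} P))^q d(⊗N(0,1))`. -/
theorem integral_eval_pow_multivariateGaussian (S : Matrix ι ι ℝ) (P : MvPolynomial ι ℝ) (q : ℕ) :
    ∫ y, (eval (WithLp.ofLp y) P) ^ q ∂(multivariateGaussian (0 : EuclideanSpace ℝ ι) S) =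
      ∫ z, (eval z (bind₁ (fun i => ∑ j, C (CFC.sqrt S i j) * X j) P)) ^ q ∂(Measure.pi fun _ : ι => gaussianReal 0 1) := by
  have hmap : multivariateGaussian (0 : EuclideanSpace ℝ ι) S =
      (Measure.pi fun _ : ι => gaussianReal 0 1).map
        (fun z : ι → ℝ => (WithLp.toLp 2 (CFC.sqrt S *ᵥ z) : EuclideanSpace ℝ ι)) := by
    rw [multivariateGaussian, ← map_pi_eq_stdGaussian, Measure.map_map (by fun_prop) (WithLp.measurable_toLp 2 _)]
    congr 1
    funext z
    simp [Matrix.toEuclideanCLM_toLp]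
  have hmeas : Measurable fun z : ι → ℝ => (WithLp.toLp 2 (CFC.sqrt S *ᵥ z) : EuclideanSpace ℝ ι) :=
    (WithLp.measurable_toLp 2 _).comp (continuous_const.matrix_mulVec continuous_id).measurable
  have hcont : Continuous fun y : EuclideanSpace ℝ ι => (eval (WithLp.ofLp y) P) ^ q :=
    ((MvPolynomial.continuous_eval P).comp (PiLp.continuous_ofLp 2 fun _ : ι => ℝ)).pow q
  rw [hmap, integral_map hmeas.aemeasurable hcont.aestronglyMeasurable]
  refine integral_congr_ae (ae_of_all _ fun z => ?_)
  simp only [eval_bind₁_linear]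

/-- **Hypercontractivity for `N(0, S)`** (Bonami–Nelson–Gross; Janson 1997 Thm 5.10, transferred from the product Gaussian): for every real matrix `S`,
every polynomial `P` of total degree `≤ d` and every `r ≥ 1`, `∫ (eval y P)^{2r} dN(0,S) ≤ (2r−1)^{rd} (∫ (eval y P)² dN(0,S))^r`. -/
theorem multivariateGaussian_bonami (S : Matrix ι ι ℝ) (d : ℕ) (P : MvPolynomial ι ℝ) (hP : P.totalDegree ≤ d)
    (r : ℕ) (hr : 1 ≤ r) :
    ∫ y, (eval (WithLp.ofLp y) P) ^ (2 * r) ∂(multivariateGaussian (0 : EuclideanSpace ℝ ι) S) ≤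
      (2 * r - 1 : ℝ) ^ (r * d) *
        (∫ y, (eval (WithLp.ofLp y) P) ^ 2 ∂(multivariateGaussian (0 : EuclideanSpace ℝ ι) S)) ^ r := by
  rw [integral_eval_pow_multivariateGaussian S P (2 * r), integral_eval_pow_multivariateGaussian S P 2]
  exact Literature.Probability.Distributions.gaussian_bonami_pi' d _ ((totalDegree_bind₁_linear_le _ P).trans hP) r hr

end Summit.QuantumFields.YangMills.Theorems.AllWindowsColdBox.GaussHypercontractivity

end
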